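import Literature.NumberTheory.Automorphic.CuspidalCohomologyGL
import Literature.NumberTheory.DiophantineGeometry.SchurWeylPlethysmProofs
import HarnessLib

/-!
# Cuspidal eigenclasses for `GL_1 / ℚ`: the rank-one case of `cuspidalEigenclass_exists`
# (cohomological side)

Topic `NumberTheory/Automorphic`; proof file (theorems only: no definition, no named fact, no
instance) under the named fact
`Literature.NumberTheory.Automorphic.GLnCohomology.cuspidalEigenclass_exists`
(`CuspidalCohomologyGL`: every cuspidal automorphic representation of `GL_n(𝔸_ℚ)` of
cohomological infinity type with a `K(N)`-fixed vector has a non-zero simultaneous Hecke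
eigenclass in `H^{b_n}_!(S(K_f(N)), Ṽ_λ ⊗ ℂ)`; Eichler–Shimura, Borel, Clozel, as summarised in
[RaghuramShahidi2010, §2.2]).  For general `n` the printed proof is the comparison of the
cohomology of `S(K_f)` with relative Lie algebra cohomology
(`H^•_cusp(S̃, M) = H^•(𝔤_∞, K_∞^0; 𝒜_cusp ⊗ M)`, Borel; [RaghuramShahidi2010, §2.2]) together with
the non-vanishing of `H^{b_n}(𝔤_∞, K^0_∞; π_∞ ⊗ M)` for cohomological `π_∞` (Clozel 1990,
Lemme 3.14), a theory the tree does not have.  This file treats the **rank-one case `n = 1`**,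
where `b_1 = 0`, `S(K_f(N)) = ℚ^×_{>0} \ 𝔸_{ℚ,f}^× / K_f(N)` is the finite ray class set, the
coefficient system `V_λ`, `λ = (λ₀)`, is the character `det^{λ₀}`, and a cuspidal automorphic
representation of `GL_1(𝔸_ℚ)` is an idèle class character `χ` with `χ_∞(t) = t^{-λ₀}` on
`ℝ_{>0}`: the eigenclass is the `H⁰`-class of the function `c ↦ χ_f(c) · w₀` on
`𝔸_{ℚ,f}^× / K_f(N)`, which is `ℚ^×_{>0}`-invariant for the twisted action precisely because
`χ_f(γ) = χ_∞(γ)⁻¹ = γ^{λ₀}` for rational `γ > 0`.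

## Main results (cohomological side, pure algebra)

* `TwistedQuotient.isInterior_of_isEmpty` — when the boundary poset `P` is empty (no proper
  rational parabolics, i.e. `G` anisotropic modulo centre — the case `GL_1`), every class is
  interior: `H^q_! = H^q`.
* `TwistedQuotient.exists_eigenclass_H0` — an invariant function `f : 𝒢 ⧸ L → V` which is an
  eigenfunction of the double-coset operators `[L g L]` gives a non-zero class in
  `H⁰(Γ, Fun(𝒢 ⧸ L, V))` with the same eigenvalues (Mathlib `groupCohomology.H0Iso`).
* `ArithmeticQuotient.heckeFun_coe_of_comm` — for commutative `𝒢` the operator `[L g L]` is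
  translation by `g`: `(T_g f)(xL) = f(xgL)`.
* `TwistedQuotient.exists_eigenclass_of_character` — for commutative `𝒢`, a character
  `χ : 𝒢 → kˣ` trivial on `L` and a vector `w₀` on which `Γ` acts through `χ ∘ ι` give a non-zero
  class in `H⁰` on which every `T_g` acts by `χ(g)`.
* `GLnCohomology.isEmpty_properSubspace_one`, `GLnCohomology.cuspidalCohomologyGL_one_eq_top` —
  `GL_1` has no proper parabolics; `H⁰_! = H⁰`.
* `GLnCohomology.weylRepCoeff_one_apply`, `GLnCohomology.coeffRepPos_one_apply`,
  `GLnCohomology.exists_ne_zero_coeffModule` — for `n = 1` the coefficient module `V_λ(k)` is a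
  non-zero space on which `GL_1(ℚ)⁺` acts by `γ ↦ γ^{λ₀}`.
* `GLnCohomology.exists_cuspidalEigenclass_one_of_character` — **the rank-one eigenclass**: a
  character `χ` of `GL_1(𝔸_{ℚ,f})` trivial on `K_f(N)` with `χ(γ) = γ^{λ₀}` on `GL_1(ℚ)⁺` gives
  `x ∈ CuspidalCohomologyGL 1 N λ`, `x ≠ 0`, with `T_g x = χ(g) x` for every `g`.

## References

* A. Raghuram, F. Shahidi, *On certain period relations for cusp forms on `GL_n`*, Int. Math.
  Res. Not. IMRN 2008, Art. ID rnn077 (doi:10.1093/imrn/rnn077; arXiv:0707.1708), §2.2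
  [RaghuramShahidi2010].
* G. Shimura, *Introduction to the arithmetic theory of automorphic functions* (1971), Ch. 3,
  §3.1 (double cosets in a commutative group) [ShimuraIATAF1971].
-/

noncomputable section

open CategoryTheory
open scoped Classical
open NumberField IsDedekindDomain

universe u

namespace Literature.NumberTheory.Automorphic

/-! ### Double-coset operators in a commutative group -/

namespace ArithmeticQuotient

variable (k : Type u) [CommRing k] {𝒢 : Type u} [Group 𝒢]

omit [CommRing k] in
variable {k} in
/-- In a commutative group the double coset `L g L` is the single coset `g L`:
`L g L / L = {gL}`. [cite: ShimuraIATAF1971, Ch. 3, §3.1] -/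
theorem doubleCosetQuot_eq_singleton_of_comm (hcomm : ∀ a b : 𝒢, a * b = b * a)
    (L : Subgroup 𝒢) (g : 𝒢) : doubleCosetQuot L g = {(g : 𝒢 ⧸ L)} := by
  ext d
  simp only [doubleCosetQuot, Set.mem_singleton_iff]
  constructor
  · rintro ⟨l, rfl⟩
    change ((l : 𝒢) • (g : 𝒢 ⧸ L)) = (g : 𝒢 ⧸ L)
    rw [MulAction.Quotient.smul_coe, smul_eq_mul, QuotientGroup.eq, hcomm (l : 𝒢) g, mul_inv_rev,
      inv_mul_cancel_right]
    exact inv_mem l.2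
  · rintro rfl
    exact MulAction.mem_orbit_self _

variable {k} in
/-- **For commutative `𝒢` the Hecke operator `[L g L]` is translation by `g`**:
`(T_g f)(xL) = f(xgL)`. [cite: ShimuraIATAF1971, Ch. 3, §3.1] -/
theorem heckeFun_coe_of_comm (hcomm : ∀ a b : 𝒢, a * b = b * a) (L : Subgroup 𝒢) (g : 𝒢)
    (M : Type u) [AddCommGroup M] [Module k M] (f : (𝒢 ⧸ L) → M) (c : 𝒢) :
    heckeFun k L g M f (c : 𝒢 ⧸ L) = f ((c * g : 𝒢) : 𝒢 ⧸ L) := by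
  have hfin : (doubleCosetQuot L g).Finite := by
    rw [doubleCosetQuot_eq_singleton_of_comm hcomm]
    exact Set.finite_singleton _
  have hset : hfin.toFinset = {(g : 𝒢 ⧸ L)} :=
    Finset.ext fun d => by
      rw [Set.Finite.mem_toFinset, doubleCosetQuot_eq_singleton_of_comm hcomm]
      simp
  rw [heckeFun_apply, dif_pos hfin, hset, Finset.sum_singleton, MulAction.Quotient.smul_coe,
    smul_eq_mul]
  obtain ⟨l, hl⟩ := QuotientGroup.mk_out_eq_mul L c
  rw [hl]
  congr 1
  rw [mul_assoc, hcomm (l : 𝒢) g, ← mul_assoc, QuotientGroup.eq, mul_inv_rev, inv_mul_cancel_right]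
  exact inv_mem l.2

end ArithmeticQuotient

/-! ### `H⁰`-classes: interior classes for an empty boundary, eigenclasses from eigenfunctions -/

namespace TwistedQuotient

open groupCohomology

variable {k : Type u} [CommRing k] {Γ 𝒢 : Type u} [Group Γ] [Group 𝒢]
variable (ι : Γ →* 𝒢) (L : Subgroup 𝒢) {V : Type u} [AddCommGroup V] [Module k V]
  (ρ : Representation k Γ V)

/-- **Every class is interior when there is no boundary**: if the poset `P` of proper rational
parabolics is empty (the group is anisotropic modulo its centre, e.g. `GL_1`), then the boundary
simplices `N(P)_p × 𝒢/L` are empty, the double complex computing `H^•(∂)` vanishes, and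
`H^q_! = H^q`. [cite: Schwermer2010, §5.3] -/
theorem isInterior_of_isEmpty (P : Type u) [Preorder P] [MulAction Γ P]
    (hP : ∀ γ : Γ, Monotone fun x : P => γ • x) [IsEmpty P] (q : ℕ) (x : cohomology ι L ρ q) :
    IsInterior ι L ρ P hP q x := by
  induction x using groupCohomology_induction_on with
  | h z =>
    have hS : ∀ p : ℕ, IsEmpty (BdrySimplex L P p) := fun p =>
      haveI : IsEmpty (Fin (p + 1) →o P) := ⟨fun f => isEmptyElim (f 0)⟩
      inferInstance
    have hsub : ∀ p j : ℕ, Subsingleton ((inhomogeneousCochains (bdryRep ι L ρ P hP p)).X j) := by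
      intro p j
      haveI := hS p
      exact ⟨fun a b => inhomogeneousCochains.ext fun g => Subsingleton.elim _ _⟩
    refine ⟨z, rfl, 0, ⟨?_, ?_, ?_⟩⟩
    · haveI := hsub 0 q
      exact Subsingleton.elim _ _
    · intro p j _
      haveI := hsub (p + 1) (j + 1)
      exact Subsingleton.elim _ _
    · haveI := hsub (q - 1 + 1) 0
      exact Subsingleton.elim _ _

/-- **Eigenclasses in `H⁰` from invariant eigenfunctions.** An invariant function
`f : 𝒢 ⧸ L → V` (`γ • f = f` for the twisted action), non-zero, which is an eigenfunction of the
double-coset operators `[L g L]`, `g ∈ S`, with eigenvalues `a g`, gives a non-zero class in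
`H⁰(Γ, Fun(𝒢 ⧸ L, V)) = Fun(𝒢 ⧸ L, V)^Γ` (Mathlib `groupCohomology.H0Iso`) with
`T_g x = a g • x` for `g ∈ S`. [folklore] -/
theorem exists_eigenclass_H0 (f : (𝒢 ⧸ L) → V) (hf : ∀ γ : Γ, coeffRepresentation ι L ρ γ f = f)
    (hf0 : f ≠ 0) (a : 𝒢 → k) (S : Set 𝒢)
    (heig : ∀ g ∈ S, ArithmeticQuotient.heckeFun k L g V f = a g • f) :
    ∃ x : cohomology ι L ρ 0, x ≠ 0 ∧ ∀ g ∈ S, heckeEnd ι L ρ g 0 x = a g • x := by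
  set A : Rep k Γ := coeffRep ι L ρ with hA
  let finv : A.ρ.invariants := ⟨f, fun γ => hf γ⟩
  have hfinv0 : finv ≠ 0 := fun h => hf0 (congrArg Subtype.val h)
  have hinj : Function.Injective (H0Iso A).hom := (H0Iso A).toLinearEquiv.injective
  have hhom : (H0Iso A).hom ((H0Iso A).inv finv) = finv := Iso.inv_hom_id_apply (H0Iso A) finv
  refine ⟨(H0Iso A).inv finv, fun hx => hfinv0 ?_, fun g hg => hinj ?_⟩
  · rw [← hhom, hx, map_zero]
  · change (H0Iso A).hom ((groupCohomology.map (MonoidHom.id Γ) (heckeRepHom ι L ρ g) 0)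
        ((H0Iso A).inv finv)) = (H0Iso A).hom (a g • (H0Iso A).inv finv)
    rw [map_id_comp_H0Iso_hom_apply, map_smul, hhom]
    refine Subtype.ext ?_
    change ArithmeticQuotient.heckeFun k L g V f = a g • f
    exact heig g hg

/-- **Eigenclasses from characters (commutative `𝒢`).** Let `𝒢` be commutative, `χ : 𝒢 →* kˣ` a
character trivial on the level `L`, and `w₀ ∈ V` a non-zero vector on which `Γ` acts through
`χ ∘ ι` (`ρ(γ) w₀ = χ(ι γ) w₀`).  Then the function `gL ↦ χ(g) w₀` is `Γ`-invariant for the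
twisted action `(γ • f)(c) = ρ(γ) f(ι(γ)⁻¹ c)`, and its class `x ∈ H⁰(Γ, Fun(𝒢 ⧸ L, V))` is
non-zero with `T_g x = χ(g) x` for every `g ∈ 𝒢` (`[L g L]` is translation by `g`,
`heckeFun_coe_of_comm`).  This is the shape of the Eichler–Shimura eigenclass for `GL_1`
(`b_1 = 0`). [folklore] -/
theorem exists_eigenclass_of_character (hcomm : ∀ a b : 𝒢, a * b = b * a) (χ : 𝒢 →* kˣ)
    (hL : ∀ u ∈ L, χ u = 1) (w₀ : V) (hw₀ : w₀ ≠ 0)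
    (hρ : ∀ γ : Γ, ρ γ w₀ = ((χ (ι γ) : kˣ) : k) • w₀) :
    ∃ x : cohomology ι L ρ 0, x ≠ 0 ∧ ∀ g : 𝒢, heckeEnd ι L ρ g 0 x = ((χ g : kˣ) : k) • x := by
  -- the function `gL ↦ χ(g) • w₀`
  let F : (𝒢 ⧸ L) → V := fun q => ((χ q.out : kˣ) : k) • w₀
  have hF : ∀ c : 𝒢, F (c : 𝒢 ⧸ L) = ((χ c : kˣ) : k) • w₀ := by
    intro c
    obtain ⟨l, hl⟩ := QuotientGroup.mk_out_eq_mul L c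
    change ((χ (QuotientGroup.mk c : 𝒢 ⧸ L).out : kˣ) : k) • w₀ = _
    rw [hl, map_mul, hL _ l.2, mul_one]
  -- invariance
  have hinv : ∀ γ : Γ, coeffRepresentation ι L ρ γ F = F := by
    intro γ
    funext q
    induction q using QuotientGroup.induction_on with
    | H c =>
      rw [coeffRepresentation_apply, MulAction.Quotient.smul_coe, smul_eq_mul, hF, hF, map_smul,
        hρ, smul_smul, ← Units.val_mul, map_mul, map_inv, inv_mul_cancel_comm]
  -- non-vanishing
  have hF0 : F ≠ 0 := by
    intro h
    have h1 := congr_fun h ((1 : 𝒢) : 𝒢 ⧸ L)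
    rw [hF, map_one, Units.val_one, one_smul, Pi.zero_apply] at h1
    exact hw₀ h1
  -- eigenfunction
  have heig : ∀ g ∈ (Set.univ : Set 𝒢),
      ArithmeticQuotient.heckeFun k L g V F = ((χ g : kˣ) : k) • F := by
    intro g _
    funext q
    induction q using QuotientGroup.induction_on with
    | H c =>
      rw [ArithmeticQuotient.heckeFun_coe_of_comm hcomm, Pi.smul_apply, hF, hF, map_mul,
        Units.val_mul, mul_comm, smul_smul]
  obtain ⟨x, hx0, hx⟩ := exists_eigenclass_H0 ι L ρ F hinv hF0 (fun g => ((χ g : kˣ) : k))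
    Set.univ heig
  exact ⟨x, hx0, fun g => hx g (Set.mem_univ g)⟩

end TwistedQuotient

/-! ### `GL_1 / ℚ`: no boundary, one-dimensional coefficients -/

namespace GLnCohomology

open Literature.NumberTheory.DiophantineGeometry

/-- **`GL_1` has no proper parabolic subgroups**: `ℚ¹` has no proper non-zero subspace.
[folklore] -/
theorem isEmpty_properSubspace_one : IsEmpty (ProperSubspace 1) := by
  refine ⟨fun W => ?_⟩
  obtain ⟨W, hbot, htop⟩ := W
  have h1 : Module.finrank ℚ (Fin 1 → ℚ) = 1 := by simp
  rcases Nat.lt_or_ge (Module.finrank ℚ W) 1 with hlt | hge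
  · exact hbot (Submodule.finrank_eq_zero.mp (Nat.lt_one_iff.mp hlt))
  · refine htop (Submodule.eq_top_of_finrank_eq ?_)
    have h2 := Submodule.finrank_le W
    omega

/-- For `n = 1` the polynomial part of the coefficient weight is empty: `d = λ₀ − λ₀ = 0`.
[folklore] -/
theorem coeffDegree_one (wt : Fin 1 → ℤ) : coeffDegree wt = 0 := by
  simp [coeffDegree, polyShift, lowestEntry_succ]

/-- Hence the index type `Fin d` of the tensor power underlying `V_λ(k)` is empty for `n = 1`.
[folklore] -/
theorem isEmpty_fin_coeffDegree_one (wt : Fin 1 → ℤ) : IsEmpty (Fin (coeffDegree wt)) :=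
  ⟨fun i => (i.cast (coeffDegree_one wt)).elim0⟩

/-- The diagonal action of `GL` on an empty tensor power is trivial. [folklore] -/
theorem glTensorRep_eq_id_of_isEmpty (σ k : Type*) [Fintype σ] [DecidableEq σ] [CommRing k]
    (d : ℕ) [IsEmpty (Fin d)] (g : GL σ k) : glTensorRep σ k d g = LinearMap.id := by
  change diagTensorRep k (σ → k) d _ = LinearMap.id
  rw [diagTensorRep_apply]
  have : (fun _ : Fin d => ((((LinearMap.GeneralLinearGroup.generalLinearEquiv k (σ → k)).toMonoidHom.comp
      (Matrix.GeneralLinearGroup.toLin (n := σ) (R := k)).toMonoidHom) g : (σ → k) ≃ₗ[k] (σ → k)) :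
        (σ → k) →ₗ[k] (σ → k))) = fun i : Fin d => (LinearMap.id : (σ → k) →ₗ[k] (σ → k)) :=
    funext fun i => isEmptyElim i
  rw [this, PiTensorProduct.map_id]

/-- **For `n = 1` the Weyl part of `V_λ(k)` is trivial**: `S_μ(g) w = w` (`μ = ∅`, `d = 0`).
[folklore] -/
theorem weylRepCoeff_one_apply (k : Type) [Field k] (wt : Fin 1 → ℤ) (g : GL (Fin 1) k)
    (w : CoeffModule k 1 wt) : weylRepCoeff k 1 wt g w = w := by
  haveI := isEmpty_fin_coeffDegree_one wt
  apply Subtype.ext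
  change ((weylRep k (Fin 1) (coeffPartition wt) g (CoeffModule.toWeyl k w) :
      weylModule k (Fin 1) (coeffPartition wt)) : TensorPower k (coeffDegree wt) (Fin 1 → k)) =
    (CoeffModule.toWeyl k w : TensorPower k (coeffDegree wt) (Fin 1 → k))
  rw [coe_weylRep_apply, glTensorRep_eq_id_of_isEmpty, LinearMap.id_apply]

/-- **For `n = 1`, `GL_1(ℚ)⁺` acts on `V_λ(k)` by the character `γ ↦ (det γ)^{λ₀} = γ^{λ₀}`.**
[cite: FultonHarrisGTM129, §15.5] -/
theorem coeffRepPos_one_apply (k : Type) [Field k] [CharZero k] (wt : Fin 1 → ℤ)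
    (γ : Matrix.GLPos (Fin 1) ℚ) (w : CoeffModule k 1 wt) :
    coeffRepPos k 1 wt γ w =
      ((Matrix.GeneralLinearGroup.det (ratPointsToField k 1 (γ : GL (Fin 1) ℚ)) ^ lowestEntry wt :
        kˣ) : k) • w := by
  change coeffRepGL k 1 wt (ratPointsToField k 1 (γ : GL (Fin 1) ℚ)) w = _
  rw [coeffRepGL_apply, weylRepCoeff_one_apply]

/-- The partition `μ = λ − λ_{n−1}` of the coefficient weight has at most `n` parts. [folklore] -/
theorem card_parts_coeffPartition_le {n : ℕ} (wt : Fin n → ℤ) :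
    (coeffPartition wt).parts.card ≤ n := by
  rw [coeffPartition_parts]
  calc ((Finset.univ.val.map (polyShift wt)).filter (· ≠ 0)).card
      ≤ (Finset.univ.val.map (polyShift wt)).card := Multiset.card_le_card (Multiset.filter_le _ _)
    _ = n := by simp

/-- **`V_λ(k) ≠ 0`** (`k` of characteristic zero): the Weyl module `S_μ(kⁿ)` of a partition with
at most `n` parts is non-zero (`weylModule_ne_bot_of_card_le`, Fulton–Harris Thm. 6.3 (1)).
[cite: FultonHarrisGTM129, §6.1 Thm. 6.3] -/
theorem exists_ne_zero_coeffModule (k : Type) [Field k] [CharZero k] {n : ℕ} (wt : Fin n → ℤ) :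
    ∃ w : CoeffModule k n wt, w ≠ 0 := by
  have hne : weylModule k (Fin n) (coeffPartition wt) ≠ ⊥ :=
    weylModule_ne_bot_of_card_le (coeffPartition wt) (by simpa using card_parts_coeffPartition_le wt)
  obtain ⟨w, hw, hw0⟩ := (Submodule.ne_bot_iff _).mp hne
  refine ⟨(⟨w, hw⟩ : weylModule k (Fin n) (coeffPartition wt)), fun h => hw0 ?_⟩
  exact congrArg Subtype.val h

/-- **`H⁰_! = H⁰` for `GL_1`**: `CuspidalCohomologyGL 1 N λ` is all of `H⁰(S(K_f(N)), Ṽ_λ)` (the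
Tits building of `GL_1` is empty). [cite: Schwermer2010, §5.3] -/
theorem cuspidalCohomologyGL_one_eq_top (N : ℕ) (wt : Fin 1 → ℤ) :
    CuspidalCohomologyGL 1 N wt = ⊤ := by
  haveI := isEmpty_properSubspace_one
  exact eq_top_iff.mpr fun x _ =>
    TwistedQuotient.isInterior_of_isEmpty (V := CoeffModule ℂ 1 wt) (diagPos 1) (level 1 N)
      (coeffRepPos ℂ 1 wt) (ProperSubspace 1) (smul_properSubspace_mono 1) (bottomDegree 1) x

/-- **The rank-one cuspidal eigenclass (cohomological side).** Let `λ = (λ₀)`, `N` a level and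
`χ : GL_1(𝔸_{ℚ,f}) → ℂˣ` a character which is trivial on `K_f(N)` and satisfies
`χ(γ) = γ^{λ₀}` (`= det(γ)^{λ_{n-1}}`) on the diagonally embedded `GL_1(ℚ)⁺` — the finite part of
an algebraic idèle class character of infinity type `t ↦ t^{-λ₀}`.  Then the class of
`c ↦ χ(c) w₀` (`w₀ ≠ 0` in the line `V_λ(ℂ)`) is a non-zero element
`x ∈ CuspidalCohomologyGL 1 N λ = H⁰_!(S(K_f(N)), Ṽ_λ)` with `T_g x = χ(g) x` for every
`g ∈ GL_1(𝔸_{ℚ,f})`, in particular a simultaneous eigenclass of all `T_{v,i}`.  This is the case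
`n = 1`, `b_1 = 0` of the Eichler–Shimura map of [RaghuramShahidi2010, §2.2].
[cite: RaghuramShahidi2010, §2.2] -/
theorem exists_cuspidalEigenclass_one_of_character (N : ℕ) (wt : Fin 1 → ℤ)
    (χ : BigHeckeGLn.FiniteAdelicGL 1 ℚ →* ℂˣ) (hL : ∀ u ∈ level 1 N, χ u = 1)
    (hΓ : ∀ γ : Matrix.GLPos (Fin 1) ℚ, χ (diagPos 1 γ) =
      Matrix.GeneralLinearGroup.det (ratPointsToField ℂ 1 (γ : GL (Fin 1) ℚ)) ^ lowestEntry wt) :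
    ∃ x ∈ CuspidalCohomologyGL 1 N wt, x ≠ 0 ∧
      ∀ g : BigHeckeGLn.FiniteAdelicGL 1 ℚ,
        heckeOp ℂ 1 N wt (bottomDegree 1) g x = ((χ g : ℂˣ) : ℂ) • x := by
  obtain ⟨w₀, hw₀⟩ := exists_ne_zero_coeffModule ℂ wt
  have hρ : ∀ γ : Matrix.GLPos (Fin 1) ℚ,
      coeffRepPos ℂ 1 wt γ w₀ = ((χ (diagPos 1 γ) : ℂˣ) : ℂ) • w₀ := fun γ => by
    rw [coeffRepPos_one_apply, hΓ]
  -- `GL_1(𝔸_{ℚ,f})` is commutative (`1 × 1` matrices over a commutative ring; the statement of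
  -- `GL_fin_one_mul_comm` of `AutomorphicLFunctionsProofs`, not imported here)
  have hcomm : ∀ a b : BigHeckeGLn.FiniteAdelicGL 1 ℚ, a * b = b * a := fun a b => by
    refine Units.ext (Matrix.ext fun i j => ?_)
    rw [Subsingleton.elim i 0, Subsingleton.elim j 0]
    simp [Matrix.mul_apply, mul_comm]
  obtain ⟨x, hx0, hx⟩ :=
    TwistedQuotient.exists_eigenclass_of_character (V := CoeffModule ℂ 1 wt) (diagPos 1)
      (level 1 N) (coeffRepPos ℂ 1 wt) hcomm χ hL w₀ hw₀ hρ
  refine ⟨x, ?_, hx0, fun g => hx g⟩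
  rw [cuspidalCohomologyGL_one_eq_top]
  trivial

end GLnCohomology

end Literature.NumberTheory.Automorphic
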